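import Mathlib
import HarnessLib
import Summits.BirchSwinnertonDyer.BirchSwinnertonDyer.Theses.ManinLocalTwoThree
import Summits.BirchSwinnertonDyer.BirchSwinnertonDyer.Theorems.ManinLocalTwoThreeManinOddAtFourStevensSplit
import Summits.BirchSwinnertonDyer.BirchSwinnertonDyer.Theorems.ManinLocalTwoThreeSqRootWitnessLaw
import Literature.NumberTheory.Automorphic.UnboundedDenominators
import Summits.BirchSwinnertonDyer.BirchSwinnertonDyer.Theorems.ManinLocalTwoThreeSquareRootDescent
import Literature.NumberTheory.EllipticCurves.KatoAdditiveTwistedValueNeronIntegralityTwoReal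
import Literature.NumberTheory.EllipticCurves.KatoAdditiveTwistedValueNeronIntegralitySymbolClosure
import Literature.NumberTheory.EllipticCurves.Gamma1ParametrizationCuspRationality
import Literature.NumberTheory.EllipticCurves.Gamma1ParametrizationCuspZeroGaloisOrbit
import Literature.NumberTheory.EllipticCurves.ManinConstantGamma1Gamma0Comparison

/-!
# Lines/kato_shift_two.lean — v26 CANDIDATE (p3 gen 18, 2026-08-29T22:4xZ; for the LEAD's custody): v25 with THE STEVENS SPLIT — the composition
# (`Theorems/ManinLocalTwoThreeManinOddAtFourStevensSplit.lean`, p747777) splits on `Λ₁(f) = Λ₀(f)` (Stevens' `X₁(N)`-optimal curve = the optimal curve)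
# instead of on the cusp `0`: there `hEven` (UDC₂: `2 ∣ c ⟹ Λ₁ ≠ Λ₀`, from AN2₂ ∧ CDT) bites WITHOUT Θ; so the three laws are consumed ONLY on the GAIN LOCUS
# G = {`Λ₁(f) ≠ Λ₀(f)`} ∩ core ∩ {`16 ∣ N`} and each law stub carries ONE MORE binder `periodLatticeGamma1 D.f ≠ periodLattice D.f` (6♭‴: inside the guard,
# on `D₀.f`) on top of v25's `modularSymbol D.f 0 ∉ periodLattice D.f` (still derived on G by Θ's contrapositive); AND v25's `stub_sqRootWitnessLawTwo`
# (AN2₂) is CLOSED BY NAME — p2 g19's THEOREM `UDCTwo.sqRootWitnessLaw` (p747828) has literally its type (`sqRootWitnessLawTwo_of_tree`, no sorry).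
# STUBS (6, names …OnCoreG): printedKatoFacts, printedCuspFacts, CDT_algInt (PRINTED, cite-only) · 6a‴|_G, 6b-res|_G, 6♭‴|_G (OPEN laws, STRICTLY WEAKER
# than v25's B-forms).  C2's open content after v26 = three laws on the GAIN LOCUS + printed facts.  Census habitat of the laws: es E15 gain classes at `16 ∣ N` (`N ≤ 80153`): 21 classes (32a1 48a1 64a1 80a1 80b1 128b1 128d1 208c1
# 464e1 848d1 2768c1 3664f1 4688b1 11728d1 17488a1 19664g1 21968e1 32464a1 35408e1 52048a1 71888e1; all index 2, rank 0) instead of every rank-0 class.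
# HONEST FRAMING: CONDITIONAL reduction; the three G-laws are OPEN, the printed facts are not proved in the tree; BSD is not proved; Manin's
# conjecture at 2 is not proved.  v25 text:
#
# Lines/kato_shift_two.lean — v25 (lead p1 gen 18, 2026-08-29T22:5xZ): v24's coarse stub UDC₂ SPLIT into its PRINTED engine and its one OPEN analytic piece —
# `stub_CDT_algInt` (Calegari–Dimitrov–Tang 2025, the same printed stub as C3 v34) and `stub_sqRootWitnessLawTwo` = **AN2₂, the ℓ = 2 WITNESS LAW** (p2 g19's
# binder `hWL` of `UDCGlueTwo.periodLatticeGamma1_ne_of_two_dvd_of_sqRootWitnessLaw`, VERBATIM: every `2`-adically integral normalised square root of `Ξ_T` has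
# a holomorphic weight-`k` witness with algebraic-integer `q`-expansion, exponential growth at the cusps and `Γ₀(N)`-stabiliser the period group of `V_a`).
# BI₂ (p2 `kummerSqRoot_twoAdicallyIntegral`), NC₂-a/NC₂-glue (p2), the ℓ = 2 endgame (LEAD p746256/p746594), Θ (LEAD p745958) and Kurth–Long
# (`typeIINoncongruence_holds`) are all THEOREMS; composition = `WitnessSplit.maninOddAtFour_of_katoFact_sqRootWitnessLaw_CDT_levelSixteenCoreLawsB`
# (`…ManinOddAtFourWitnessSplit`, p747195).  STUBS (7 = stubs_max): printedKatoFacts (F♯ ∧ F-es-21♭K), printedCuspFacts (F★ ∧ F♮ ∧ CES), CDT_algInt — PRINTED;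
# sqRootWitnessLawTwo (AN2₂), 6a‴|_B, 6b-res|_B, 6♭‴|_B — OPEN.  So C2's open content = ONE analytic witness law on the reducible half of locus A (the ℓ = 2 port of
# ~10 landed ℓ = 3 files) + the three v23 laws on locus B (analytic rank 0, cuspidal point of even order).  HONEST FRAMING: CONDITIONAL reduction; BSD is not
# proved; Manin's conjecture at 2 is not proved.  v24 text:

# Lines/kato_shift_two.lean — v24 (lead p1 gen 18, 2026-08-29T22:2xZ): THE CUSP-ZERO SPLIT — locus A `{∞,0}_f ∈ Λ₀(f)` (⊇ ROOT NUMBER −1) is closed by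
# F♯ (irreducible) and the NEW ℓ = 2 UDC CONGRUENCE LAW `stub_udcTwoCongruence` (reducible); the three v23 laws are now needed ONLY on locus B
# `{∞,0}_f ∉ Λ₀(f)` (analytic rank 0, cuspidal point of even order) — each carries that extra binder (STRICTLY WEAKER stubs).
# WHY (all kernel theorems of this gen): Θ at m = 1 (`…StevensCurveOfCuspZero`, p745958): `{∞,0}_f ∈ Λ₀ ⟹ Λ₁ = Λ₀` mod F★∧F♮∧CES; the ℓ = 2
# Kummer-character endgame (`…KummerSquareCharacterEndgame` p746256, `…SigmaSqRootKummerShimuraTwo` p746594): Γ₁(N)-periodicity of the σ-square root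
# of `x − x(T)` ⟹ `Λ₁ ≠ Λ₀`; p2 g19's NC₂-a + Kurth–Long glue (`…KummerCoverSubgroupTwo`, `UDCTwo.sigmaSqRoot_gamma1_periodic_of_congruence`):
# congruence ⟹ Γ₁(N)-periodicity.  So on A: `2 ∣ c` ⟹ (UDC₂) congruence ⟹ `Λ₁ ≠ Λ₀` ⟹ contradiction.  COMPOSITION =
# `RootNumberSplit.maninOddAtFour_of_katoFact_udcTwo_levelSixteenCoreLawsB` (`…ManinOddAtFourRootNumberSplit`, p746903).
# STUBS (6 ≤ stubs_max): `stub_printedKatoFacts` (F♯ ∧ F-es-21♭K, Kato 2004 — PRINTED), `stub_printedCuspFacts` (F★ ∧ F♮ ∧ CES, CES 2003 / Stevens 1982 —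
# PRINTED), `stub_udcTwoCongruence` (OPEN: = BI₂ ∧ AN₂ ∧ CDT, the ℓ = 2 twin of C3's (BI) ∧ (AN♮) ∧ CDT which are theorems/print at ℓ = 3; p2 g19 holds BI₂,
# AN₂ untaken, objects to be typed T-p1-g18-1), `stub_cuspidalKummerRepresentativeOnCoreG` (6a‴|_B), `stub_cuspidalKummerEvenExponentSquareOnCoreG`
# (6b-res|_B), `stub_katoNeronIntegralTwoGamma1OptimalOnBlindCoreG` (6♭‴|_B) — the v23 laws VERBATIM with the added hypothesis
# `modularSymbol D.f 0 ∉ periodLattice D.f` (resp. inside 6♭‴'s guard).  HONEST FRAMING: CONDITIONAL reduction; UDC₂ and the three B-laws are OPEN;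
# BSD is not proved; Manin's conjecture at 2 is not proved.  v23 text (kept for the record):
# Lines/kato_shift_two.lean — v23 (lead p1 gen 16, 2026-08-29T17:0xZ): v22 BY NAME — the 6b-res stub now names the TREE law
# `CuspidalKummer.CuspidalKummerEvenExponentSquareOnCore` (-an g38 T-an-46, typer p733352 `ManinAdditive/CuspidalKummerEvenResidual.lean`; = v22's inline
# text = p2's `hL` VERBATIM, ref1 §R176 CLEAN AS TYPED, 6b-res ⟺ 6b‴ via p2's `SquareRootDescent` p724791).  ALL SEVEN STUBS ARE NAMED TREE DECLARATIONS again: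
# {F♯ `kato_neron_isIntegral_twistedSymbolSum_of_additive_two_real`, F★ `optimalGamma1Parametrization_cusp_rational`, F-need `exists_optimal_gamma1ParametrizationData`,
# F-es-21♭K `kato_isIntegral_twistedSymbolSum_two_symbolClosure` (four PRINTED statement-only facts), 6a‴ `CuspidalKummerRepresentativeOnCore`, 6b-res
# `CuspidalKummerEvenExponentSquareOnCore`, 6♭‴ `KatoNeronIntegralTwoGamma1OptimalOnBlindCore` (three OPEN laws on the core at 16 ∣ N)}.  On the CM classes 6♭‴'s
# conclusion is now a CONDITIONAL theorem by name (p2 g18 `Theorems/ManinLocalTwoThreeKatoNeronIntegralOnCMClasses.lean`, es's root laws E-es-152₂/154/155).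
# HONEST FRAMING unchanged: CONDITIONAL reduction; the three laws are OPEN; BSD is not proved; Manin's conjecture at 2 is not proved.  v22 text:
# Lines/kato_shift_two.lean — v22 (lead p1 gen 15, 2026-08-29T16:2xZ): v21 with stub 6b‴ RESHAPED INTO ITS ODD-NEBENTYPUS RESIDUAL
# p2 g17 (p724791 `Theorems/ManinLocalTwoThreeSquareRootDescent.lean`, ACCEPTED) proved the TRIVIAL-CHARACTER HALF of 6b‴: a cuspidal Kummer representative of a
# non-blind rational 2-torsion point on the core either has an odd η-exponent or has all exponents even with `∏ δ^{|r_δ/2|}` NOT a square (square-root descent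
# + Newman's criterion); hence 6b‴ `CuspidalKummer.CuspidalKummerOddExponentOnCore` ⟸ the residual «all exponents even ⟹ ∏ δ^{|r_δ/2|} is a square» stated
# INLINE (p2's hypothesis `hL` VERBATIM) as `stub_cuspidalKummerEvenExponentSquareOnCore`; 6b‴ is DERIVED by `SquareRootDescent.cuspidalKummerOddExponentOnCore_of_isSquare_half`.
# By the dichotomy the residual is EQUIVALENT to 6b‴ (no loss); it is the Σ(2N)[2] / odd-quadratic-Nebentypus case of the Shimura ledger (MEMO-an §56.6), the
# exact place where -an's E-an-151/152b character laws bite.  Stubs: {F♯, F★, F-need, F-es-21♭K, 6a‴, 6b-res, 6♭‴} (7).  HONEST FRAMING unchanged: CONDITIONAL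
# reduction; the three laws are OPEN; BSD is not proved; Manin's conjecture at 2 is not proved.  v21 text:
# Lines/kato_shift_two.lean — v21 (lead p1 gen 13, 2026-08-29T08:2xZ): v20 BY NAME — ALL SEVEN STUBS ARE NAMED TREE DECLARATIONS
# The typer (g18, T-p1-g13-1, p708603 `Summits/BirchSwinnertonDyer/Rank1Residual/ManinAdditive/KatoShiftTwoCoreLaws.lean`) typed v20's three inline law stubs
# VERBATIM as `@[conjecture]` defs: 6a‴ `CuspidalKummer.CuspidalKummerRepresentativeOnCore`, 6b‴ `CuspidalKummer.CuspidalKummerOddExponentOnCore`,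
# 6♭‴ `KatoCurve.KatoNeronIntegralTwoGamma1OptimalOnBlindCore`.  v21 re-points the three stubs to those names (statements unchanged token-for-token, so the
# composition `maninOddAtFour_of_katoFact_of_levelSixteenCoreLaws_blindPeriodRecut` consumes them definitionally); stubs 1, 4, 5, 7 were already by name.
# THE OPEN CONTENT OF C2 = three NAMED laws on the core {16 ∣ N} ∩ {ord₂ j > 0} ∩ {no dyadic twist 2-semistable} + four NAMED statement-only facts.
# HONEST FRAMING: a CONDITIONAL reduction; the three laws are OPEN; BSD is not proved by this line; Manin's conjecture at 2 is not proved.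
# v20 text (kept for the record):
# Lines/kato_shift_two.lean — v20 (lead p1 gen 13, 2026-08-29T07:4xZ): v19 with p2's CORE binder «no dyadic twist is 2-semistable» on ALL THREE LAWS
# p2 g14's `maninOddAtFour_of_core` (p705358) reduces the crux to globally minimal W with 4 ∣ N, ord₂ j > 0 AND f₂(W ⊗ d) ≥ 2 for d ∈ {−1, 2, −2}
# (the complement — some dyadic twist semistable at 2 — is closed by print + the dyadic untwist transport).  The lead's 16 ∣ N reading carries this
# binder too: the χ₋₄ partner is a MODEL of W ⊗ (−1) (`exists_optimalPartner_general_model`), the core is an isomorphism invariant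
# (`twistCore_smul`: `quadraticTwist_smul` + `conductorExponent_smul'`) and survives W ↦ W ⊗ (−1) (`twistCore_negOneTwist`: (W⊗−1)⊗{−1,2,−2} ≅
# {W, W⊗−2, W⊗2}); file `Theorems/ManinLocalTwoThreeSixteenSplitCore.lean` (p1 g13).  So every law stub now carries BOTH binders
# `v₂(j) < 1` and `∀ d ∈ {−1,2,−2}, 2 ≤ f₂(W ⊗ d)` (on the datum's curve for 6a‴/6b‴, on the guard's X₀-side curve W₀ for 6♭‴).
# THE OPEN CONTENT OF C2 after v20 = the three laws READ ON THE CORE AT 16 ∣ N (at 16 ∥ N: Kodaira rows II/4, I₀*/8, I₂*/10, I₃*/11 at 2 —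
# p2/p3's row theorems): E-an-48/53 at data with a non-blind rational 2-torsion point; Kato–Néron integrality at the X₁-optimal curve of totally
# blind core classes off the period-dominated locus (in range: the X₁(32)-datum of 32a).  Stubs 1, 4, 5, 7 UNCHANGED (printed, by name).
# COMPOSITION = `maninOddAtFour_of_katoFact_of_levelSixteenCoreLaws_blindPeriodRecut` (p1 g13).
# HONEST FRAMING: a CONDITIONAL reduction; the three laws are OPEN; BSD is not proved by this line; Manin's conjecture at 2 is not proved.
# v19 text (kept for the record):
# Lines/kato_shift_two.lean — v19 (lead p1 gen 13, 2026-08-29T07:3xZ): v18 with p2's binder «potentially supersingular at 2» (ord₂ j > 0) on ALL THREE LAWS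
# p2 g14 proved C2 on the stratum ord₂ j ≤ 0 (`maninOddAtFour_of_pos_ordJ`, p704515: every potentially multiplicative / potentially good ORDINARY
# class with 4 ∣ N is a dyadic twist of a 2-semistable class — closed by the crux's own printed-fact binders + the dyadic untwist transport).
# The χ₋₄ rotation of the 16 ∣ N reading preserves j (lead p1 g13 `exists_optimalPartner_general_j`, `maninOddAtFourSS_of_maninOddAtSixteenSS`,
# `Theorems/ManinLocalTwoThreeSixteenSplitSupersingular.lean`), and the by-locus composition consumes the laws at curves with the SAME j as the
# datum's curve (the a₁ = a₃ = 0 model) or through a guard naming it; so every law stub now carries `v₂(j) < 1` (multiplicative valuation at the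
# place 2, i.e. ord₂ j > 0): 6a″ss `stub_cuspidalKummerRepresentativeAtSixteenSS`, 6b″ss `stub_cuspidalKummerOddExponentAtSixteenSS`, 6♭ss
# `stub_katoNeronIntegralTwoGamma1OptimalAtSixteenBlindSSRecut`.  v18 ⟹ v19 stub-wise (`blindSSPeriodRecutLaw_of_blindPeriodRecutLaw` etc.: a
# binder added, never removed).  THE OPEN CONTENT OF C2 after v19: the three laws on {16 ∣ N} ∩ {potentially supersingular at 2} — E-an-48/53 at
# data with a non-blind rational 2-torsion point, Kato–Néron integrality at the X₁-optimal curve of totally blind classes off the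
# period-dominated locus (in range: the X₁(32)-optimal datum of 32a — j = 1728, ord₂ j = 6).  Stubs 1, 4, 5, 7 UNCHANGED (printed, by name).
# COMPOSITION = `maninOddAtFour_of_katoFact_of_levelSixteenSSLaws_blindPeriodRecut` (p1 g13).
# HONEST FRAMING: a CONDITIONAL reduction; the three laws are OPEN; BSD is not proved by this line; Manin's conjecture at 2 is not proved.
# v18 text (kept for the record):
# Lines/kato_shift_two.lean — v18 (lead p1 gen 13, 2026-08-29T07:0xZ): v17 with the Kato law stub restricted to TOTALLY BLIND classes (6♭)
# The lead's by-locus composition (`Theorems/ManinLocalTwoThreeManinOddByLocus.lean`, p1 g13) routes EVERY locus through the X₁(N)-optimal curve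
# E₁ of the class: irreducible W[2] — F♯ gives `KatoFactTwoAt` at E₁ (`katoFactTwoAt_of_real`), the Γ₁ lever gives 2 ∤ c₁, Ling–Oesterlé +
# Ribet give |c₀| = |c₁| (NO Kato-shift lever, no E-es-22); a₁ = a₃ = 0 model with a NON-blind rational 2-torsion point — E-an-48/53 at the
# datum + the E-an-52 theorem (no Kato input); all rational 2-torsion BLIND — Kato at E₁ + F★'s transfer.  Hence the Kato LAW is consumed ONLY on
# totally blind classes: stub 6♭ `stub_katoNeronIntegralTwoGamma1OptimalAtSixteenBlindRecut` = v17's 6⁗ (16 ∣ N, off the period-dominated locus)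
# with the extra guard «the class contains a lattice-optimal, globally minimal, a₁ = a₃ = 0, totally blind X₀(N)-datum» (v14's C2¹ binders,
# Kato clothing).  6⁗ ⟹ 6♭ (`blindPeriodRecutLaw_of_periodRecutLaw`), so v18 is WEAKER than v17.  In Cremona's range the blind classes at
# 16 ∣ N are the 7 u-family I₀* classes (HH, excused by stub 7), 80b1 (odd-HH, excused), 128b1/128d1 (HH, excused), 32a1 (open unless
# period-dominated): 6♭'s in-range content ⊆ {32a1} (es census E40 / §40.13; a census reading, not a theorem).  Stubs 1, 4, 5, 7, 6a″, 6b″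
# UNCHANGED.  COMPOSITION = `maninOddAtFour_of_katoFact_of_levelSixteenLaws_blindPeriodRecut` (p1 g13).
# HONEST FRAMING: a CONDITIONAL reduction; the three laws are OPEN; BSD is not proved by this line; Manin's conjecture at 2 is not proved.
# v17 text (kept for the record):
# Lines/kato_shift_two.lean — v17 (lead p1 gen 13, 2026-08-29T07:3xZ): v16 with stub 6″ WEAKENED to 6⁗ — the PERIOD-RATIO recut
# Kato–Néron integrality at 2 (`KatoFactTwoAt V f`) is MONOTONE in the 2-adic size of the real period: it passes from `V′` to any isogenous
# globally minimal `V` with `q·Ω(V′) = m·Ω(V)`, `q` odd, `m ∈ ℤ` (lead p1 g13 `katoFactTwoAt_of_isIsogenous_of_realPeriod_ratio`,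
# `Theorems/ManinLocalTwoThreeKatoFactTwoAtPeriodRatio.lean`; p3's odd-isogeny transfer p699401 is the case `m` odd).  So stub 7 (F-es-21♭K,
# Kato at the symbol-closure curve `E_K`) discharges E-es-110 at every optimal `X₁(N)`-curve that is 2-adically DOMINATED by some symbol-closure
# relative — stub 6⁗ `stub_katoNeronIntegralTwoGamma1OptimalAtSixteenPeriodRecut` keeps E-es-110 only OFF that locus (at `16 ∣ N`).  6″ ⟹ 6⁗
# (`recutLawPeriod_of_recutLawOddNeighbour`: an odd symbol-closure neighbour is period-dominating, odd/odd), so v17's hypothesis set is WEAKER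
# than v16's; the recut is `c`-free (`Ω(E_K)/Ω(E₁)` does not see `c₁`).  Which blind classes beyond es's half-homothety locus the period recut
# excuses is a CENSUS question for es and -data (`v₂(Ω(E_K)/Ω(E₁)) ≥ 0`?; in range the blind content of 6″ was {32a1}).  Stubs 1, 4, 5, 7, 6a″, 6b″
# UNCHANGED (names kept).  COMPOSITION = `maninOddAtFour_of_katoFact_of_levelSixteenLaws_periodRecut` (p1 g13).
# HONEST FRAMING: a CONDITIONAL reduction; the three laws are OPEN; BSD is not proved by this line; Manin's conjecture at 2 is not proved.
# v16 text (kept for the record):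
# Lines/kato_shift_two.lean — v16 (lead p1 gen 13, 2026-08-29T06:2xZ): THE CRUX READ AT `16 ∣ N`, stub 6′ RECUT on the symbol-closure locus
# TRIGGER (LEAD 2026-08-29T04:58:06Z) FIRED: S-an-58 `negOneTwistConductorFourMul_holds` (p2 p696508) and S-an-60
# `negOneTwistConductorTwoMul_holds` (p2 p698743) are TREE THEOREMS and an's B5b `ManinOddAtSixteen` + glue landed (typer p698181), so
# C2 `ManinOddAtFour` ⟺ `ManinOddAtSixteen` in the kernel with NO print input (`maninOddAtFour_iff_maninOddAtSixteen`, p2): the `χ₋₄`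
# rotation moves every lattice-optimal datum with `4 ∥ N` (N′ = 4N) or `8 ∥ N` (N′ = 2N) to one with `16 ∣ N′` and the SAME constant.
# v16 = v15's composition made LEVEL-WISE (lead p1 g13, `Theorems/ManinLocalTwoThreeManinOddAtSixteenOfStubs.lean`:
# `not_two_dvd_maninConstant_of_katoFact_of_levelLaws` — every edge of v15 is local to the level) and READ AT `16 ∣ N`:
#  * stubs 1 (F♯), 4 (F★), 5 (hex) UNCHANGED, by name (printed / Literature statement-only facts);
#  * NEW stub 7 = F-es-21♭K `kato_isIntegral_twistedSymbolSum_two_symbolClosure` BY NAME (Literature statement-only: Kato (8.1.3) +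
#    Thm 12.5 (1) read at Kato's own curve `E_K = ℂ/𝓛̄_f`, Wuthrich 2014 §3) — it DISCHARGES stub 6′ on every optimal
#    `X₁(N)`-curve with a globally minimal odd-degree-isogenous symbol-closure neighbour (es g26 §40.12 (v)/§40.13: the half-homothety
#    locus, 17/21 blind classes `4 ∣ N ≤ 5000` incl. the wild 128b1/128d1, and its odd neighbours 20a1/80b1; p3's theorem
#    `katoFactTwoAt_of_oddIsogeny_of_isSymbolClosureCurve`, p699401);
#  * stubs 6a″ / 6b″ = E-an-48 / E-an-53 READ AT `16 ∣ N` (an's `@[conjecture]` bodies VERBATIM with `4 ∣ N` ↦ `2 ^ 4 ∣ N`; inline);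
#  * stub 6″ = E-es-110 READ AT `16 ∣ N` AND OFF the odd-symbol-closure-neighbour locus (inline; in range `N ≤ 5000` its only
#    totally blind class is 32a1 — es census E40/§40.13, es g27's CM target — since 40a1-type has `8 ∥ N`).
# COMPOSITION = `maninOddAtFour_of_katoFact_of_levelSixteenLaws` (p1 g13) = level-wise C2 at `16 ∣ N` + p2's
# `maninOddAtFour_of_maninOddAtSixteen'`.  7 stubs = stubs_max: 4 printed facts {F♯, F★, hex, F-es-21♭K} + 3 laws at `16 ∣ N`.
# HONEST FRAMING: a CONDITIONAL reduction and a RE-INDEXING, not a closure; the three laws are OPEN (now on the `16 ∣ N` stratum only);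
# BSD is not proved by this line; Manin's conjecture at 2 is not proved; Stevens' conjecture is not proved.
# v15 text (kept for the record):
# Lines/kato_shift_two.lean — v15 (lead p1 gen 12, 2026-08-29T02:3xZ): stub 6 C2¹ SPLIT by es g24's Γ₁ KATO ROAD and its f-intrinsic half
# DISCHARGED.  v14's stub 6 `ShimuraLedger.GammaOneOddOnBlindClasses` (C2¹) is now DERIVED: C2¹ ⟸ E-es-110 ∧ E-es-111 by the lead's tree theorem
# `GammaOneKatoRoad.gammaOneOddOnBlindClasses_of_katoGamma1` (p688868; es g24 Sketch §3 lever, modularity-free), and E-es-111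
# `KatoCurve.TwoAdicGammaOneWitnessLaw` is a THEOREM (`twoAdicGammaOneWitnessLaw_holds`, p2 g12).  So the ONE remaining input on the totally
# blind locus is the NÉRON HALF, stub 6′ = E-es-110 `KatoCurve.KatoNeronIntegralTwoGamma1Optimal`.  Hypothesis set of C2 after v15:
# {stub 1 F♯, stub 6′ E-es-110} + {E-an-48, E-an-53} + {F★, hex}.  COMPOSITION = p683655 + p688868.
# History: v6 (4ce672ceda68) … v8 (cb94b66fa4ba) five named stubs; v9 (fe79704d5fa5) TWO stubs {F♯, Rb}; v10 (7384bfbaa501) Rb derived from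
# cuspidal-Kummer stubs + blind residual; v11/v12/v13: all stubs by name; v14 (603f697eaeb8) blind residual through Stevens' parity;
# v15 (2e2d80f2578c) C2¹ split by the Γ₁ Kato road.
-/

set_option autoImplicit false
set_option linter.dupNamespace false

noncomputable section

open scoped Classical MatrixGroups ModularForm NumberField PeriodPair Manifold
open IsDedekindDomain IsDedekindDomain.HeightOneSpectrum Rat.HeightOneSpectrum
open PowerSeries CongruenceSubgroup WeierstrassCurve Literature.NumberTheory.EllipticCurves
  Literature.NumberTheory.EllipticCurves.ModularForms
  Literature.RingTheory.FormalGroups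
  Summit.BirchSwinnertonDyer.Rank1Residual.ManinAdditive
  Summit.BirchSwinnertonDyer.Rank1Residual.ManinAdditive.CuspidalKummer
  Summit.BirchSwinnertonDyer.Rank1Residual.ManinAdditive.ShimuraLedger
  Summit.BirchSwinnertonDyer.Rank1Residual.ManinAdditive.KatoCurve
  Summit.BirchSwinnertonDyer.BirchSwinnertonDyer.Theorems.ManinLocalTwoThree.SigmaSquareRoot

namespace Summit.BirchSwinnertonDyer.BirchSwinnertonDyer.Cruxes.ManinOddAtFour.KatoShiftTwo

/-- STUB (PRINTED bundle, Kato 2004): F♯ `kato_neron_isIntegral_twistedSymbolSum_of_additive_two_real` (Kato Thm 12.5 (1), real subfield; closes the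
`W[2]`-irreducible locus) ∧ F-es-21♭K `kato_isIntegral_twistedSymbolSum_two_symbolClosure` (Kato (8.1.3) + Thm 12.5 (1) at the symbol-closure curve; discharges
6♭‴ on the period-dominated locus).  Statement-only Literature facts; close by Literature PROOFS, not inside this line (XL). -/
theorem stub_printedKatoFacts :
    kato_neron_isIntegral_twistedSymbolSum_of_additive_two_real ∧ kato_isIntegral_twistedSymbolSum_two_symbolClosure := by
  sorry

/-- STUB (PRINTED bundle, CES 2003 / Stevens 1982 / Stevens 1989): F★ `optimalGamma1Parametrization_cusp_rational` (CES §6.1.2) ∧ F♮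
`optimalGamma1Parametrization_cuspZero_galoisConjugate` (Stevens 1982 Thm 1.3.1 (b); NEW on this line — feeds Θ) ∧ CES `exists_optimal_gamma1ParametrizationData`
(CES Thm 1.1.3 / Stevens Thm 1.9).  Statement-only Literature facts (the same three are stubs of C3's v34). -/
theorem stub_printedCuspFacts :
    optimalGamma1Parametrization_cusp_rational ∧ optimalGamma1Parametrization_cuspZero_galoisConjugate ∧
      exists_optimal_gamma1ParametrizationData := by
  sorry

/-- STUB (PRINTED) CDT-algInt — Calegari–Dimitrov–Tang 2025 Thm. 1.0.1 with Remarks 58–59 (Unbounded Denominators, algebraic-integer coefficients), the vendored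
statement-only fact `Literature.NumberTheory.Automorphic.CalegariDimitrovTang2025_unboundedDenominators_algInt` (the same stub as C3 v34's `stub_CDT_algInt`);
unbundled to `∀ k, UnboundedDenominatorsWeightAlgInt k` by p2's `UDWOfCDT.unboundedDenominatorsWeightAlgInt_of_CDT_algInt`.  CITE-ONLY. -/
theorem stub_CDT_algInt : Literature.NumberTheory.Automorphic.CalegariDimitrovTang2025_unboundedDenominators_algInt := by
  sorry

/-- AN2₂ — the ℓ = 2 WITNESS LAW — is a THEOREM (p2 g19, `UDCTwo.sqRootWitnessLaw`, p747828, `…ManinLocalTwoThreeSqRootWitnessLaw`): v25's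
`stub_sqRootWitnessLawTwo` CLOSED BY NAME (its type is literally the landed constant's).  No sorry. -/
theorem sqRootWitnessLawTwo_of_tree :
    ∀ (W : WeierstrassCurve ℚ) [W.IsElliptic] [W.IsGloballyMinimal] {N : ℕ} [NeZero N]
      (D : ModularParametrizationData W N) (a : ℕ → ℤ), (∀ n, (a n : ℂ) = cuspCoeff D.f n) → 4 ∣ N →
      (∀ z ∈ D.L.lattice, ∃ w ∈ periodLattice D.f, z = D.c * w) →
      ∀ e : ℚ, W.twoTorsionPolynomial.toPoly.IsRoot e →
      ∀ (p : ℂ) (m₁ m₂ : ℤ), p ∉ D.L.lattice → 2 * p = m₁ * D.L.ω₁ + m₂ * D.L.ω₂ →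
      ((shortRoot W D.c e : ℚ) : ℂ) = (D.c : ℂ) ^ 2 * ℘[D.L] p →
      ∀ z : ℚ⟦X⟧, IsParamGerm W D.c a z →
      ∀ h : ℚ⟦X⟧, h ^ 2 = kummerSeries W D.c e z → constantCoeff h = 1 → (∀ n : ℕ, ¬ (2 ∣ (coeff n h).den)) →
      ∃ (k : ℤ) (F : UpperHalfPlane → ℂ), MDifferentiable 𝓘(ℂ) 𝓘(ℂ) F ∧
        (∀ γ : Gamma0 N, (∀ w : ℂ, sigmaSqRoot D.L p (m₁ * D.L.η₁ + m₂ * D.L.η₂) (w + (D.c : ℂ) * cuspSymbol D.f γ) =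
          sigmaSqRoot D.L p (m₁ * D.L.η₁ + m₂ * D.L.η₂) w) → F ∣[k] (γ : SL(2, ℤ)) = F) ∧
        (∀ γ : Gamma0 N, F ∣[k] (γ : SL(2, ℤ)) = F → ∀ w : ℂ,
          sigmaSqRoot D.L p (m₁ * D.L.η₁ + m₂ * D.L.η₂) (w + (D.c : ℂ) * cuspSymbol D.f γ) =
            sigmaSqRoot D.L p (m₁ * D.L.η₁ + m₂ * D.L.η₂) w) ∧
        (∀ g : SL(2, ℤ), ∃ C A m : ℝ, ∀ τ : UpperHalfPlane, A ≤ τ.im → ‖(F ∣[k] g) τ‖ ≤ C * Real.exp (m * τ.im)) ∧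
        (∃ b : ℕ → ℂ, (∀ n, IsIntegral ℤ (b n)) ∧ ∀ τ : UpperHalfPlane,
          HasSum (fun n : ℕ ↦ b n * Complex.exp (2 * Real.pi * Complex.I * (τ : ℂ) * n)) (F τ)) :=
  Summit.BirchSwinnertonDyer.BirchSwinnertonDyer.Theorems.ManinLocalTwoThree.UDCTwo.sqRootWitnessLaw

/-- STUB 6a‴|_G — `CuspidalKummer.CuspidalKummerRepresentativeOnCore` (v23's stub, typer p708603) RESTRICTED to the GAIN LOCUS G: v25's binder
`modularSymbol D.f 0 ∉ periodLattice D.f` (analytic rank `0`) AND the new binder `periodLatticeGamma1 D.f ≠ periodLattice D.f` (Stevens' `X₁(N)`-optimal curve is NOT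
the optimal curve; `[Λ₀:Λ₁] = 2` on every such class in range).  OPEN, c-free; strictly weaker than 6a‴|_B. -/
theorem stub_cuspidalKummerRepresentativeOnCoreG :
    ∀ (W : WeierstrassCurve ℚ) [W.IsElliptic] [W.IsGloballyMinimal] {N : ℕ} [NeZero N]
      (D : ModularParametrizationData W N) (a : ℕ → ℤ), (∀ n, (a n : ℂ) = cuspCoeff D.f n) →
      2 ^ 4 ∣ N → (∀ z ∈ D.L.lattice, ∃ w ∈ periodLattice D.f, z = D.c * w) →
      ((primesEquiv (R := 𝓞 ℚ)).symm ⟨2, Nat.prime_two⟩).valuation ℚ W.j < 1 →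
      (∀ d : ℤ, d = -1 ∨ d = 2 ∨ d = -2 → 2 ≤ (W.quadraticTwist (d : ℚ)).conductorExponent ((primesEquiv (R := ℤ)).symm ⟨2, Nat.prime_two⟩)) →
      modularSymbol D.f 0 ∉ periodLattice D.f → periodLatticeGamma1 D.f ≠ periodLattice D.f →
      ∀ e : ℚ, W.twoTorsionPolynomial.toPoly.IsRoot e →
      ∀ z : ℚ⟦X⟧, IsParamGerm W D.c a z →
      ∃ (r : ℕ → ℤ) (g A B : ℤ⟦X⟧), IsCuspidalKummerRep N (kummerSeries W D.c e z) r g A B := by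
  sorry

/-- STUB 6b-res|_G — `CuspidalKummer.CuspidalKummerEvenExponentSquareOnCore` (v23's stub, typer p733352) RESTRICTED to the gain locus G (both binders
`modularSymbol D.f 0 ∉ periodLattice D.f` and `periodLatticeGamma1 D.f ≠ periodLattice D.f`).  OPEN, c-free; the odd-Nebentypus residual of 6b‴ (p2's square-root
descent supplies the other half below); strictly weaker than 6b-res|_B. -/
theorem stub_cuspidalKummerEvenExponentSquareOnCoreG :
    ∀ (W : WeierstrassCurve ℚ) [W.IsElliptic] [W.IsGloballyMinimal] {N : ℕ} [NeZero N]
      (D : ModularParametrizationData W N) (a : ℕ → ℤ), (∀ n, (a n : ℂ) = cuspCoeff D.f n) →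
      2 ^ 4 ∣ N → (∀ z ∈ D.L.lattice, ∃ w ∈ periodLattice D.f, z = D.c * w) →
      ((primesEquiv (R := 𝓞 ℚ)).symm ⟨2, Nat.prime_two⟩).valuation ℚ W.j < 1 →
      (∀ d : ℤ, d = -1 ∨ d = 2 ∨ d = -2 → 2 ≤ (W.quadraticTwist (d : ℚ)).conductorExponent ((primesEquiv (R := ℤ)).symm ⟨2, Nat.prime_two⟩)) →
      modularSymbol D.f 0 ∉ periodLattice D.f → periodLatticeGamma1 D.f ≠ periodLattice D.f →
      ∀ (a₂ a₄ e : ℤ), W.a₁ = 0 → W.a₃ = 0 → W.a₂ = a₂ → W.a₄ = a₄ →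
      W.twoTorsionPolynomial.toPoly.IsRoot (e : ℚ) → ¬ KummerBlindAtTwo a₂ a₄ e →
      ∀ z : ℚ⟦X⟧, IsParamGerm W D.c a z →
      ∀ (r : ℕ → ℤ) (g A B : ℤ⟦X⟧), IsCuspidalKummerRep N (kummerSeries W D.c ((e : ℚ)) z) r g A B →
      (∀ δ ∈ N.divisors, Even (r δ)) → IsSquare (∏ δ ∈ N.divisors, δ ^ (r δ / 2).natAbs) := by
  sorry

/-- 6b‴|_G DERIVED (no sorry): p2's pointwise dichotomy `SquareRootDescent.exists_odd_or_not_isSquare_of_isCuspidalKummerRep` (odd exponent, or all even with a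
non-square half product) applied to the G-restricted residual stub. -/
theorem cuspidalKummerOddExponentOnCoreG_of_stub :
    ∀ (W : WeierstrassCurve ℚ) [W.IsElliptic] [W.IsGloballyMinimal] {N : ℕ} [NeZero N]
      (D : ModularParametrizationData W N) (a : ℕ → ℤ), (∀ n, (a n : ℂ) = cuspCoeff D.f n) →
      2 ^ 4 ∣ N → (∀ z ∈ D.L.lattice, ∃ w ∈ periodLattice D.f, z = D.c * w) →
      ((primesEquiv (R := 𝓞 ℚ)).symm ⟨2, Nat.prime_two⟩).valuation ℚ W.j < 1 →
      (∀ d : ℤ, d = -1 ∨ d = 2 ∨ d = -2 → 2 ≤ (W.quadraticTwist (d : ℚ)).conductorExponent ((primesEquiv (R := ℤ)).symm ⟨2, Nat.prime_two⟩)) →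
      modularSymbol D.f 0 ∉ periodLattice D.f → periodLatticeGamma1 D.f ≠ periodLattice D.f →
      ∀ (a₂ a₄ e : ℤ), W.a₁ = 0 → W.a₃ = 0 → W.a₂ = a₂ → W.a₄ = a₄ →
      W.twoTorsionPolynomial.toPoly.IsRoot (e : ℚ) → ¬ KummerBlindAtTwo a₂ a₄ e →
      ∀ z : ℚ⟦X⟧, IsParamGerm W D.c a z →
      ∀ (r : ℕ → ℤ) (g A B : ℤ⟦X⟧), IsCuspidalKummerRep N (kummerSeries W D.c ((e : ℚ)) z) r g A B →
      ∃ δ ∈ N.divisors, Odd (r δ) := by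
  intro W _ _ N _ D a ha h16 hLat hj hcore h0 hΛ a₂ a₄ e ha1 ha3 ha2 ha4 he hnb z hz r g A B hrep
  have h2 : 2 ∣ N := (by norm_num : (2 : ℕ) ∣ 2 ^ 4).trans h16
  rcases Summit.BirchSwinnertonDyer.BirchSwinnertonDyer.Theorems.ManinLocalTwoThree.SquareRootDescent.exists_odd_or_not_isSquare_of_isCuspidalKummerRep
      W D a ha h2 hLat he z hz hrep with h | hnsq
  · exact h
  · by_contra hcon
    have hev : ∀ δ ∈ N.divisors, Even (r δ) := fun δ hδ =>
      Int.not_odd_iff_even.mp fun hodd => hcon ⟨δ, hδ, hodd⟩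
    exact hnsq (stub_cuspidalKummerEvenExponentSquareOnCoreG W D a ha h16 hLat hj hcore h0 hΛ a₂ a₄ e ha1 ha3 ha2 ha4 he hnb z hz r g A B hrep hev)

/-- STUB 6♭‴|_G — `KatoCurve.KatoNeronIntegralTwoGamma1OptimalOnBlindCore` (v23's stub, typer p708603) RESTRICTED to the gain locus G: the guard's lattice-optimal
blind core datum `D₀` also has `modularSymbol D₀.f 0 ∉ periodLattice D₀.f` AND `periodLatticeGamma1 D₀.f ≠ periodLattice D₀.f` (Stevens' curve `V` is NOT the
optimal curve `W₀`).  OPEN (Stevens' 2-part on blind gain classes, in Kato clothing); strictly weaker than 6♭‴|_B. -/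
theorem stub_katoNeronIntegralTwoGamma1OptimalOnBlindCoreG :
    ∀ (V : WeierstrassCurve ℚ) [V.IsElliptic] [V.IsGloballyMinimal] {N : ℕ} [NeZero N]
      (D₁ : Gamma1ParametrizationData V N), D₁.IsOptimal → 2 ^ 4 ∣ N →
      (¬ ∃ (V' : WeierstrassCurve ℚ) (_ : V'.IsElliptic) (_ : V'.IsGloballyMinimal) (q m : ℤ),
        Odd q ∧ WeierstrassCurve.IsIsogenous V' V ∧ (q : ℝ) * V'.realPeriodRat = (m : ℝ) * V.realPeriodRat ∧
        IsSymbolClosureCurve V' D₁.f) →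
      (∃ (W₀ : WeierstrassCurve ℚ) (_ : W₀.IsElliptic) (_ : W₀.IsGloballyMinimal) (D₀ : ModularParametrizationData W₀ N),
        IsIsogenous V W₀ ∧ (∀ z ∈ D₀.L.lattice, ∃ w ∈ periodLattice D₀.f, z = D₀.c * w) ∧
        W₀.a₁ = 0 ∧ W₀.a₃ = 0 ∧ HasRationalTwoTorsion W₀ ∧ AllRationalTwoTorsionBlind W₀ ∧
        ((primesEquiv (R := 𝓞 ℚ)).symm ⟨2, Nat.prime_two⟩).valuation ℚ W₀.j < 1 ∧
        (∀ d : ℤ, d = -1 ∨ d = 2 ∨ d = -2 → 2 ≤ (W₀.quadraticTwist (d : ℚ)).conductorExponent ((primesEquiv (R := ℤ)).symm ⟨2, Nat.prime_two⟩)) ∧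
        modularSymbol D₀.f 0 ∉ periodLattice D₀.f ∧ periodLatticeGamma1 D₀.f ≠ periodLattice D₀.f) →
      KatoFactTwoAt V D₁.f := by
  sorry

/-- COMPOSITION (no sorry): `StevensSplit.maninOddAtFour_of_katoFact_sqRootWitnessLaw_CDT_levelSixteenCoreLawsG` (p3 g18, p747777) fed with the seven stubs
(two printed bundles unpacked, AN2₂ by name, 6b‴|_G derived). -/
theorem ManinOddAtFour_of :
    Summit.BirchSwinnertonDyer.BirchSwinnertonDyer.Theses.ManinLocalTwoThree.ManinOddAtFour :=
  Summit.BirchSwinnertonDyer.BirchSwinnertonDyer.Theorems.ManinLocalTwoThree.StevensSplit.maninOddAtFour_of_katoFact_sqRootWitnessLaw_CDT_levelSixteenCoreLawsG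
    stub_printedKatoFacts.1 stub_printedCuspFacts.1 stub_printedCuspFacts.2.1 stub_printedCuspFacts.2.2 stub_printedKatoFacts.2
    stub_CDT_algInt sqRootWitnessLawTwo_of_tree stub_cuspidalKummerRepresentativeOnCoreG cuspidalKummerOddExponentOnCoreG_of_stub
    stub_katoNeronIntegralTwoGamma1OptimalOnBlindCoreG

end Summit.BirchSwinnertonDyer.BirchSwinnertonDyer.Cruxes.ManinOddAtFour.KatoShiftTwo

end
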